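import Mathlib
import Summits.Ventures.HodgeRepro2.Tier7.Line3.HeckeWindowSatake
import Summits.Ventures.HodgeRepro2.Tier7.Line3.HeckeWindowSixOrb

/-!
# Tier7/Line3/HeckeWindowElement — the window as ONE element of the abstract Hecke algebra (part IX of the Hecke-window lane)
(parts I–III = HeckeWindowCounts / HeckeWindowSums / HeckeWindowLocus; IV–V = HeckeWindowIdeal / HeckeWindowIdealOrb;
VI–VII = HeckeWindowSix / HeckeWindowSixOrb; VIII = HeckeWindowSatake)

Filer: t7-L1-p3 (gen 8, prover-pub-hodge-repro2-t7-L1-p3-g8-0), self-selected on the seat's own TARGET line (STATUS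
l. 15887; twin window held). Lane: Line 3 SUPPORT, [M]-level; NOT a line, NOT a device; touches neither residual
clause (a′) nor (b′) of the line.

WHAT IT SUPPLIES. §3b (L3-ARGUMENT.md) needs, at one split place `v₂ ∉ S`, a Hecke function `f_{v₂}` whose Satake
transform lies in the ideal `(α − c)(β − c)·ℋ` (so it kills the pole class on the spectral side) and whose orbital
integral `O_{γ₀}(f_{v₂})` is non-zero. Parts IV–VIII supply the two halves separately: the Satake side on the window
ELEMENT `winFn n` of any commutative `ℂ`-algebra satisfying the printed relations (part VIII, `satake_winFn`), and the
orbital side on the §2c model's sequence `W_n = windowSeq (orbSum χ · 0) (β₁β₂) c κ n` (parts V / VII,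
`exists_le_five_windowSeq_orbSum_ne_zero`). THIS FILE puts both on the SAME element: with a `ℂ`-linear functional
`O : A →ₗ[ℂ] ℂ` (the orbital integral `O_{γ₀}`) whose values on the basis elements are the model's sums —
`O (charFn n) = vol · orbSum χ n 0` and, on the central translates `1_{ϖK} · 1_{K diag(ϖⁿ,1) K} = 1_{K diag(ϖ^{n+1},ϖ) K}`,
`O (R * charFn n) = vol · orbSum χ (n+1) 1` — one has `O (winFn n) = vol · W_n` (`orbital_winFn`), hence
THE THEOREM (`exists_le_five_window_element`): for a unitary datum, `‖c‖ = 1`, `0 < ‖κ‖ < 1`, `vol ≠ 0`,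
  `∃ n ≤ 5, S (winFn n) = (α − c)(β − c) · mac κ α β n ∧ O (winFn n) ≠ 0`,
and its pole-class form (`exists_le_five_window_element_root`): `c ∈ {α, β} ⇒ ∃ n ≤ 5, S (winFn n) = 0 ∧ O (winFn n) ≠ 0`.

WHAT STAYS IN WORDS (the dictionary, (a′)): that the real `ℋ(GL₂(F_{v₂}) // K)` with its spherical character at `π_{v₂}`
satisfies (6.3) + (6.6) (Bump 1997 Prop. 4.6.4 / 4.6.6 as printed — part VIII's header), and that the real orbital
integral `O_{γ₀}` takes the §2c model's values `vol · orbSum` on the basis elements (parts I–II computed the model's sums;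
the Cartan model and the identification of the real `U(W_A)(F_{v₂})`, `T_A`, `T_B`, `K`, `γ₀ h`, `μ_A`, `μ_B`, `χ_V` with
the model's objects are print / dictionary). `hO` / `hOR` are the DISPLAYED form of that bridge — a datum clause on
`(A, T, R, S, O)`, not a theorem — so the lane's [W] clause «the bridge to `O_{γ₀}`» is NARROWED to it, not removed
(crit-2 l. 15891 (2)). Nothing about `X`, (N) or (P) is claimed.

§8(d) (uses an L-value-free non-vanishing device): NO — linearity and the landed theorems.
-/

namespace Summit.Ventures.HodgeRepro2.Tier7.Line3.HeckeWindow

section Element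

variable {A : Type*} [CommRing A] [Algebra ℂ A]

/-- (K18) (E1) THE ORBITAL VALUE OF THE WINDOW ELEMENT. For a `ℂ`-linear functional `O` (the orbital integral `O_{γ₀}`)
with `O (charFn n) = vol · orbSum χ n 0` and `O (R * charFn n) = vol · orbSum χ (n+1) 1` (the bridge to `O_{γ₀}`,
displayed as data), `O (winFn n) = vol · W_n` with `W_n = windowSeq (orbSum χ · 0) (β₁ β₂) c κ n` (part IV's sequence;
the central translate `orbSum χ (n+1) 1 = β₁ β₂ · orbSum χ n 0` is part V's `orbSum_succ_one`). At `n = 0` the third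
term consumes `hOR` at `n − 1 = 0` (natural subtraction: `charFn (0 − 1) = charFn 0`, value `vol · orbSum χ 1 1`) multiplied
by `lowCoeff κ 0 = 0` — it vanishes, the value is still `vol · W_0`, and no `orbSum χ (−1) 1` ever appears (the convention
of `winFn` / `windowSeq`; crit-2 l. 15891 (1)). -/
theorem orbital_winFn (T : ℕ → A) (R : A) (O : A →ₗ[ℂ] ℂ) (χ : UnramChar) (vol c κ : ℂ)
    (hO : ∀ n : ℕ, O (charFn T R n) = vol * orbSum χ (n : ℤ) 0)
    (hOR : ∀ n : ℕ, O (R * charFn T R n) = vol * orbSum χ ((n : ℤ) + 1) 1) (n : ℕ) :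
    O (winFn T R c κ n) = vol * windowSeq (fun m : ℕ => orbSum χ (m : ℤ) 0) (χ.β₁ * χ.β₂) c κ n := by
  unfold winFn windowSeq
  rw [map_add, map_sub, map_sub, map_smul, map_smul, map_smul, hO n, hOR n, hO (n + 1), hOR (n - 1),
    orbSum_succ_one, orbSum_succ_one]
  simp only [smul_eq_mul]
  ring

/-- (K18) (E2) THE THEOREM — THE WINDOW AS ONE ELEMENT: in any commutative `ℂ`-algebra with the printed relations (6.3)
and (6.6) (Bump Prop. 4.6.4 / 4.6.6; `hT0`, `hrec`, `hS1`, `hSR`, `κ² q = 1`), with a linear functional `O` taking the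
§2c model's values on the basis (`hO`, `hOR`), for every unitary datum `χ`, every `‖c‖ = 1`, `‖κ‖ < 1` and `vol ≠ 0`:
one of the six fixed window elements `winFn 0, …, winFn 5` has Satake value `(α − c)(β − c) · mac κ α β n`
(so it lies in the ideal of the pole class) AND non-zero orbital value. -/
theorem exists_le_five_window_element (T : ℕ → A) (R : A) (q : ℕ) (S : A →ₐ[ℂ] ℂ) (O : A →ₗ[ℂ] ℂ)
    (χ : UnramChar) (vol κ α β c : ℂ)
    (hκq : κ ^ 2 * (q : ℂ) = 1) (hT0 : T 0 = 1)
    (hrec : ∀ k : ℕ, 1 ≤ k → T 1 * T k = T (k + 1) + (q : A) * R * T (k - 1))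
    (hS1 : S (T 1) = κ⁻¹ * (α + β)) (hSR : S R = α * β)
    (hO : ∀ n : ℕ, O (charFn T R n) = vol * orbSum χ (n : ℤ) 0)
    (hOR : ∀ n : ℕ, O (R * charFn T R n) = vol * orbSum χ ((n : ℤ) + 1) 1)
    (hχ : χ.Unitary) (hc : ‖c‖ = 1) (hκ : ‖κ‖ < 1) (hvol : vol ≠ 0) :
    ∃ n, n ≤ 5 ∧ S (winFn T R c κ n) = (α - c) * (β - c) * mac κ α β n ∧ O (winFn T R c κ n) ≠ 0 := by
  have hκ0 : κ ≠ 0 := kappa_ne_zero_of_sq_mul κ q hκq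
  obtain ⟨n, hn, h⟩ := exists_le_five_windowSeq_orbSum_ne_zero χ hχ c κ hc hκ0 hκ
  refine ⟨n, hn, satake_winFn T R q S κ α β c hκq hT0 hrec hS1 hSR n, ?_⟩
  rw [orbital_winFn T R O χ vol c κ hO hOR n]
  exact mul_ne_zero hvol h

/-- (K18) (E3) THE POLE-CLASS FORM: if the parameter `{α, β}` contains `c`, one of the six window elements has Satake
value `0` and non-zero orbital value. -/
theorem exists_le_five_window_element_root (T : ℕ → A) (R : A) (q : ℕ) (S : A →ₐ[ℂ] ℂ) (O : A →ₗ[ℂ] ℂ)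
    (χ : UnramChar) (vol κ α β c : ℂ)
    (hκq : κ ^ 2 * (q : ℂ) = 1) (hT0 : T 0 = 1)
    (hrec : ∀ k : ℕ, 1 ≤ k → T 1 * T k = T (k + 1) + (q : A) * R * T (k - 1))
    (hS1 : S (T 1) = κ⁻¹ * (α + β)) (hSR : S R = α * β)
    (hO : ∀ n : ℕ, O (charFn T R n) = vol * orbSum χ (n : ℤ) 0)
    (hOR : ∀ n : ℕ, O (R * charFn T R n) = vol * orbSum χ ((n : ℤ) + 1) 1)
    (hχ : χ.Unitary) (hc : ‖c‖ = 1) (hκ : ‖κ‖ < 1) (hvol : vol ≠ 0) (hcαβ : c = α ∨ c = β) :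
    ∃ n, n ≤ 5 ∧ S (winFn T R c κ n) = 0 ∧ O (winFn T R c κ n) ≠ 0 := by
  obtain ⟨n, hn, hS, hO'⟩ :=
    exists_le_five_window_element T R q S O χ vol κ α β c hκq hT0 hrec hS1 hSR hO hOR hχ hc hκ hvol
  refine ⟨n, hn, ?_, hO'⟩
  rw [hS]
  rcases hcαβ with h | h <;> rw [h] <;> ring

end Element

end Summit.Ventures.HodgeRepro2.Tier7.Line3.HeckeWindow
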